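import Summits.SmoothPoincare4.SmoothPoincare4.Theses.SymplecticOrigami
import Literature.Topology.FourManifolds.IntersectionLatticeProofs
import Literature.Topology.FourManifolds.IntersectionFormTopologyRankProofs
import Literature.Topology.FourManifolds.TrisectionFunctorSPC4Proofs
import Literature.AlgebraicTopology.SingularHomology.PoincareDualityProofs
import Literature.AlgebraicTopology.SingularHomology.OrientationProofs
import Literature.Geometry.Kaehler.ManifoldForms
import Literature.Geometry.Symplectic.CanonicalClassSqAndAdjunctionOfSymplecticFour

/-!
# Stub `stub_genusFormula` of line `pair-rigidity-endgame` (crux `SymplecticOrigami.OrigamiRung`)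

Per piece `(N, s)` of the fold: a closed connected symplectic `4`-manifold with
`rank H₂(N; ℤ) = 1`, a compact connected symplectically embedded surface `b : S ↪ N` with
`rank H₁(S; ℤ) = 2g`, and `H₁(N ∖ b(S); ℤ) ≅ ℤᵏ` free; claim `k + g² = 3g` and `b₁(N) = k`.
The tree PROVES the singular-homology layer this needs (Poincaré duality, unimodularity,
`b₂ = b₂⁺ + b₂⁻`, Betti symmetry, `χ = Σ (-1)ⁱ bᵢ`), but has NO canonical class of a symplectic
`4`-manifold, no adjunction formula and no Thom–Gysin sequence of a surface complement.  Those
two published inputs were stated inline as cited named facts over existing tree vocabulary and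
RELOCATED by the gate (p83557) to `Literature/Geometry/Symplectic/CanonicalClassSqAndAdjunctionOfSymplecticFour.lean`
(`HomologicalOrientation`, `cupPairing`, `intersectionForm`, `signature`, `relEuler`,
`poincareDualityMap`, `singularHomology.map`, `fundamentalClass`), for relocation to `Literature/`:

* `canonicalClass_sq_and_adjunction_of_symplectic_four` — Chern-number package of a closed
  symplectic `4`-manifold (McDuff–Salamon 2017, (4.1.7), Def. 4.1.4, (4.4.5) = (13.3.17), §4.4):
  an orientation `μ` and `K ∈ H²(N; ℤ)` with `b₂⁺ ≥ 1`, `K² = 2χ + 3σ`, and for every symplectic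
  surface `S`: `[S]` is not torsion and `2g(S) − 2 = S·S + K·S`;
* `thomGysin_complement_surface_four` — exactness of
  `H₂(N) —(·S)→ ℤ → H₁(N ∖ S) → H₁(N) → 0` for a closed oriented surface in a closed oriented
  smooth `4`-manifold (Bredon 1993, VI.11; Hatcher 2002, §2.1, §3.3).

From them `stub_genusFormula_of_canonicalClass_of_thomGysin` proves the registered signature
sorry-free (rank-one lattice `ℤe`, `Q(e,e) = 1`; `[S] = me`, `K = ce`; `δ = 0`, `m = ±1`,
`H₁(N ∖ S) ≅ H₁(N)`; `σ = 1`, `χ = 3 − 2k`, `c² = 9 − 4k`, `2g − 2 = 1 + cm`; the one-piece form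
of the landed arithmetic `…OrigamiRung.Negative.swFreeDichotomy`).  The stub itself stays open:
it is `stub_genusFormula_of_canonicalClass_of_thomGysin h₁ h₂` for the two facts.
-/

noncomputable section

-- the prescribed namespace `Summit.<P>.<Sub>.…` duplicates `SmoothPoincare4` (P = Sub)
set_option linter.dupNamespace false

open scoped Manifold ContDiff Topology ContinuousMap
open Set TopologicalSpace
open Literature.Topology.FourManifolds (singularHomologyZ)
open Literature.Geometry.Kaehler (MForm IsSmoothForm IsClosedForm)

namespace Summit.SmoothPoincare4.SmoothPoincare4.Theorems.OrigamiRung.PairRigidityEndgame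

/-- Model space `ℝⁿ`. -/
local notation "𝔼" n:arg => EuclideanSpace ℝ (Fin n)
/-- The round 4-sphere. -/
local notation "𝕊⁴" => (Metric.sphere (0 : EuclideanSpace ℝ (Fin 5)) 1)
/-- The round 2-sphere. -/
local notation "𝕊²" => (Metric.sphere (0 : EuclideanSpace ℝ (Fin 3)) 1)
/-- The closed unit 4-ball with its manifold-with-boundary structure (`ClosedBall.lean`). -/
local notation "𝔻⁴" => (Metric.closedBall (0 : EuclideanSpace ℝ (Fin (3 + 1))) 1)

open Literature.AlgebraicTopology.SingularHomology Literature.Topology.FourManifolds Module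

/-! ### Rank-one lattices -/

section Lattice

variable {R : Type*} [CommRing R] {V : Type*} [AddCommGroup V] [Module R V]

/-- Every vector of a rank-one free module is a multiple of the basis vector. [folklore] -/
theorem eq_repr_smul_of_basis_fin_one (B : Basis (Fin 1) R V) (v : V) :
    v = B.repr v 0 • B 0 := by
  have h := B.sum_repr v
  rw [Fin.sum_univ_one] at h
  exact h.symm

/-- In a rank-one free module, a vector with vanishing coordinate is zero. [folklore] -/
theorem eq_zero_of_repr_eq_zero (B : Basis (Fin 1) R V) {v : V} (h : B.repr v 0 = 0) : v = 0 := by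
  rw [eq_repr_smul_of_basis_fin_one B v, h, zero_smul]

/-- A bilinear form on multiples of one vector: `Q (n • e) (m • e) = n m Q(e, e)`. [folklore] -/
theorem apply_smul_smul_eq (Q : LinearMap.BilinForm R V) (e : V) (n m : R) :
    Q (n • e) (m • e) = n * m * Q e e := by
  rw [LinearMap.BilinForm.smul_left, LinearMap.BilinForm.smul_right, mul_assoc]

/-- On a rank-one free module with basis vector `e` and `Q(e, e) = 1`, the form is the product
of coordinates. [folklore] -/
theorem apply_eq_repr_mul_repr (Q : LinearMap.BilinForm R V) (B : Basis (Fin 1) R V)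
    (hu : Q (B 0) (B 0) = 1) (x y : V) : Q x y = B.repr x 0 * B.repr y 0 := by
  conv_lhs => rw [eq_repr_smul_of_basis_fin_one B x, eq_repr_smul_of_basis_fin_one B y]
  rw [apply_smul_smul_eq, hu, mul_one]

end Lattice
section IntLattice

variable {V : Type*} [AddCommGroup V] [Module ℤ V]

/-- On a rank-one lattice with basis vector `e`, a unimodular (perfect) form has `Q(e, e) = ±1`
(Milnor–Husemoller 1973, §I.2: a unimodular Gram determinant is `±1`). [folklore] -/
theorem apply_self_eq_one_or_eq_neg_one_of_isPerfPair (Q : LinearMap.BilinForm ℤ V)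
    (hQ : Q.IsPerfPair) (B : Basis (Fin 1) ℤ V) :
    Q (B 0) (B 0) = 1 ∨ Q (B 0) (B 0) = -1 := by
  haveI := hQ
  obtain ⟨v, hv⟩ := (LinearMap.IsPerfPair.bijective_left Q).2 (B.coord 0)
  have h1 : Q v (B 0) = 1 := by
    rw [hv, Basis.coord_apply, Basis.repr_self, Finsupp.single_eq_same]
  rw [eq_repr_smul_of_basis_fin_one B v, LinearMap.BilinForm.smul_left] at h1
  rcases Int.eq_one_or_neg_one_of_mul_eq_one' h1 with ⟨-, h⟩ | ⟨-, h⟩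
  exacts [Or.inl h, Or.inr h]

/-- If `b⁺(Q) ≥ 1` then some vector has positive square. [folklore] -/
theorem exists_apply_self_pos_of_one_le_sigPos [Module.Finite ℤ V] (Q : LinearMap.BilinForm ℤ V)
    (h : 1 ≤ sigPos Q.toQuadraticMap) : ∃ x : V, 0 < Q x x := by
  obtain ⟨W, hW, hpd⟩ := exists_finrank_eq_sigPos_and_posDef Q.toQuadraticMap
  have hW0 : W ≠ ⊥ := by
    rintro rfl
    rw [finrank_bot] at hW
    omega
  obtain ⟨w, hwW, hw0⟩ := (Submodule.ne_bot_iff W).1 hW0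
  refine ⟨w, ?_⟩
  have hpos := hpd ⟨w, hwW⟩ (fun h0 => hw0 (congrArg Subtype.val h0))
  simpa using hpos

end IntLattice

/-! ### The conditional genus formula -/

/-- **The registered stub, conditional on the two named facts above.**  For a closed connected
symplectic `4`-manifold `(N, s)` with `rank H₂(N; ℤ) = 1`, a compact connected symplectic
surface `b : S ↪ N` with `rank H₁(S; ℤ) = 2g` and `H₁(N ∖ b(S); ℤ) ≅ ℤᵏ`: `k + g² = 3g` and
`rank H₁(N; ℤ) = k`.  Proof: the rank-one unimodular lattice `H²(N; ℤ)/T = ℤe` has `Q(e,e) = 1`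
(`b₂⁺ ≥ 1`); with `[S] ↔ m e`, `K ↔ c e` the Thom–Gysin sequence and the freeness of
`H₁(N ∖ S)` give `δ = 0`, `m = ±1`, `H₁(N ∖ S) ≅ H₁(N)`; then `σ(N) = 1`, `χ(N) = 3 − 2k`,
`c² = 2χ + 3σ = 9 − 4k`, `2g − 2 = m² + cm = 1 + cm`, so `(2g − 3)² = 9 − 4k`.
(McDuff–Salamon 2017 (4.1.7), (4.4.5); Bredon 1993 VI.11.) [folklore] -/
theorem stub_genusFormula_of_canonicalClass_of_thomGysin :
    Literature.Geometry.Symplectic.canonicalClass_sq_and_adjunction_of_symplectic_four →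
    Literature.Geometry.Symplectic.thomGysin_complement_surface_four →
    ∀ (N : Type) [TopologicalSpace N] [T2Space N] [SecondCountableTopology N] [CompactSpace N]
      [ConnectedSpace N] [ChartedSpace (𝔼 4) N] [IsManifold (𝓡 4) ∞ N]
      (s : MForm (𝓡 4) N ℝ 2)
      (S : Type) [TopologicalSpace S] [CompactSpace S] [ConnectedSpace S] [ChartedSpace (𝔼 2) S]
      [IsManifold (𝓡 2) ∞ S] (b : S → N),
      IsSmoothForm s → IsClosedForm s →
      (∀ x (v : TangentSpace (𝓡 4) x), v ≠ 0 → ∃ w, s x ![v, w] ≠ 0) →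
      Manifold.IsSmoothEmbedding (𝓡 2) (𝓡 4) ∞ b →
      (∀ y (v : TangentSpace (𝓡 2) y), v ≠ 0 → ∃ w : TangentSpace (𝓡 2) y,
        s (b y) ![mfderiv (𝓡 2) (𝓡 4) b y v, mfderiv (𝓡 2) (𝓡 4) b y w] ≠ 0) →
      Module.finrank ℤ (singularHomologyZ N 2) = 1 →
      ∀ (g k : ℕ), Module.finrank ℤ (singularHomologyZ S 1) = 2 * g →
        Nonempty (singularHomologyZ (↥((Set.range b)ᶜ)) 1 ≃+ (Fin k → ℤ)) →
        k + g * g = 3 * g ∧ Module.finrank ℤ (singularHomologyZ N 1) = k := by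
  intro hS hT N _ _ _ _ _ _ _ s S _ _ _ _ _ b hs hcl hnd hb hbnd hH2 g k hH1S hcompl
  obtain ⟨μ, K, hpos, hKK, hsurf⟩ := hS N s hs hcl hnd
  obtain ⟨μS, htor, hadjAll⟩ := hsurf S b hb hbnd
  clear hsurf
  obtain ⟨σ, hσ⟩ := (poincare_duality μ (two_add_two_eq_four : 2 + 2 = 4)).2
    (singularHomology.map ℤ ℤ ⟨b, hb.isEmbedding.continuous⟩ 2 μS.fundamentalClass)
  have hadj := hadjAll σ hσ
  clear hadjAll
  obtain ⟨hsurj, δ, hδrange, hδker⟩ := hT N μ S μS b hb σ hσ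
  obtain ⟨ε₀⟩ := hcompl
  have ε : ↥(singularHomology ℤ ℤ (↥((Set.range b)ᶜ)) 1) ≃+ (Fin k → ℤ) := ε₀
  clear ε₀
  -- tree facts about the lattice `H²(N; ℤ)/T` and its intersection form `Q`
  have hU := isUnimodular_intersectionForm_holds (X := N) two_add_two_eq_four μ
  have hsum := finrank_eq_sigPos_add_sigNeg_intersectionForm_holds (X := N) even_two
    two_add_two_eq_four μ
  have hsigdef : μ.signature =
      (sigPos (intersectionForm two_add_two_eq_four μ).toQuadraticMap : ℤ) -
        sigNeg (intersectionForm two_add_two_eq_four μ).toQuadraticMap := rfl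
  have hmk : ∀ a a' : singularCohomology ℤ ℤ N 2, cupPairing μ two_add_two_eq_four a a' =
      intersectionForm two_add_two_eq_four μ (freeCohomology.mk a) (freeCohomology.mk a') :=
    fun _ _ => rfl
  obtain ⟨Q, hQdef⟩ : ∃ Q : LinearMap.BilinForm ℤ ↥(freeCohomology ℤ N 2),
      intersectionForm two_add_two_eq_four μ = Q := ⟨_, rfl⟩
  rw [hQdef] at hU hsum hsigdef hmk hpos
  haveI : Module.Finite ℤ ↥(freeCohomology ℤ N 2) := finite_freeCohomology
    (finite_singularCohomology_of_compactSpace_of_isPrincipalIdealRing ℤ N 4 2)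
  haveI : Module.Free ℤ ↥(freeCohomology ℤ N 2) := free_freeCohomology
    (finite_singularCohomology_of_compactSpace_of_isPrincipalIdealRing ℤ N 4 2)
  have hrank : Module.finrank ℤ ↥(freeCohomology ℤ N 2) = 1 := by
    rw [finrank_freeCohomology_two_eq_bettiNumber_of_compactSpace, ← bettiNumber_int_eq_rat]
    exact hH2
  obtain ⟨B, -⟩ : ∃ _ : Basis (Fin 1) ℤ ↥(freeCohomology ℤ N 2), True :=
    ⟨Module.finBasisOfFinrankEq ℤ _ hrank, trivial⟩
  -- `Q(e, e) = 1`: unimodularity gives `±1`, and `b⁺ ≥ 1` fixes the sign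
  have hu : Q (B 0) (B 0) = 1 := by
    obtain ⟨x, hx⟩ := exists_apply_self_pos_of_one_le_sigPos Q hpos
    rw [eq_repr_smul_of_basis_fin_one B x, apply_smul_smul_eq] at hx
    rcases apply_self_eq_one_or_eq_neg_one_of_isPerfPair Q hU B with h | h
    · exact h
    · exfalso
      rw [h] at hx
      nlinarith [mul_self_nonneg (B.repr x 0)]
  have hpair : ∀ a a' : singularCohomology ℤ ℤ N 2, cupPairing μ two_add_two_eq_four a a' =
      B.repr (freeCohomology.mk a) 0 * B.repr (freeCohomology.mk a') 0 := fun a a' => by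
    rw [hmk]; exact apply_eq_repr_mul_repr Q B hu _ _
  -- coordinates `m` of `[S]` and `c` of `K`
  obtain ⟨m, hmdef⟩ : ∃ m : ℤ, B.repr (freeCohomology.mk σ) 0 = m := ⟨_, rfl⟩
  obtain ⟨c, hcdef⟩ : ∃ c : ℤ, B.repr (freeCohomology.mk K) 0 = c := ⟨_, rfl⟩
  have hσσ : cupPairing μ two_add_two_eq_four σ σ = m * m := by rw [hpair, hmdef]
  have hKσ : cupPairing μ two_add_two_eq_four K σ = c * m := by rw [hpair, hmdef, hcdef]
  have hKK2 : cupPairing μ two_add_two_eq_four K K = c * c := by rw [hpair, hcdef]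
  -- `m ≠ 0`: `[S]` is not a torsion class
  have hm0 : m ≠ 0 := by
    intro hm
    apply htor
    rw [← hσ]
    have hmk0 : freeCohomology.mk σ = 0 := eq_zero_of_repr_eq_zero B (hmdef.trans hm)
    exact Submodule.mem_comap.1 (freeCohomology.torsion_le_comap_torsion
      (poincareDualityMap μ two_add_two_eq_four) ((freeCohomology.mk_eq_zero_iff σ).1 hmk0))
  -- Thom–Gysin: `m ∈ ker δ`, so `δ 1` has finite order in the free group `H₁(N ∖ S)`: `δ = 0`
  obtain ⟨a₀, ha₀⟩ := freeCohomology.mk_surjective (R := ℤ) (X := N) (k := 2) (B 0)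
  have hma : (cupPairing μ two_add_two_eq_four).flip σ a₀ = m := by
    rw [LinearMap.flip_apply, hpair, ha₀, Basis.repr_self, Finsupp.single_eq_same, one_mul, hmdef]
  have hδm : δ m = 0 := by
    have hmem : m ∈ LinearMap.ker δ := by
      rw [hδker]; exact LinearMap.mem_range.2 ⟨a₀, hma⟩
    exact LinearMap.mem_ker.1 hmem
  have hδ1 : δ 1 = 0 := by
    obtain ⟨φ, hφ⟩ : ∃ φ : ℤ →ₗ[ℤ] (Fin k → ℤ), φ = ε.toIntLinearEquiv.toLinearMap.comp δ :=
      ⟨_, rfl⟩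
    have hφm : φ m = 0 := by
      rw [hφ, LinearMap.comp_apply, LinearEquiv.coe_coe, hδm, map_zero]
    have h := φ.map_smul m 1
    rw [smul_eq_mul, mul_one, hφm] at h
    rcases smul_eq_zero.1 h.symm with h' | h'
    · exact absurd h' hm0
    · rw [hφ, LinearMap.comp_apply, LinearEquiv.coe_coe] at h'
      exact (LinearEquiv.map_eq_zero_iff _).1 h'
  have hδ0 : δ = 0 := LinearMap.ext_ring (by rw [hδ1, LinearMap.zero_apply])
  -- hence `m = ±1` …
  have hmm : m * m = 1 := by
    have htop : LinearMap.range ((cupPairing μ two_add_two_eq_four).flip σ) = ⊤ := by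
      rw [← hδker, hδ0, LinearMap.ker_zero]
    have h1 : (1 : ℤ) ∈ LinearMap.range ((cupPairing μ two_add_two_eq_four).flip σ) := by
      rw [htop]; exact Submodule.mem_top
    obtain ⟨a, ha⟩ := LinearMap.mem_range.1 h1
    rw [LinearMap.flip_apply, hpair, hmdef] at ha
    rcases Int.eq_one_or_neg_one_of_mul_eq_one' ha with ⟨-, h⟩ | ⟨-, h⟩ <;> rw [h] <;> norm_num
  -- … and `H₁(N ∖ S) ≅ H₁(N)`, so `b₁(N) = k`
  have hk1 : Module.finrank ℤ ↥(singularHomology ℤ ℤ (↥((Set.range b)ᶜ)) 1) = k := by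
    rw [ε.toIntLinearEquiv.finrank_eq, Module.finrank_fin_fun]
  have hb1 : Module.finrank ℤ ↥(singularHomology ℤ ℤ N 1) = k := by
    rw [← hk1]
    have hinj : Function.Injective (singularHomology.map ℤ ℤ
        (⟨Subtype.val, continuous_subtype_val⟩ : C(↥((Set.range b)ᶜ), N)) 1).hom := by
      rw [← LinearMap.ker_eq_bot, ← hδrange, hδ0, LinearMap.range_zero]
    exact (LinearEquiv.ofBijective _ ⟨hinj, hsurj⟩).finrank_eq.symm
  refine ⟨?_, hb1⟩
  -- Betti numbers of `N`: `χ(N) = 3 - 2k`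
  have hb0 : Module.finrank ℤ (singularHomology ℤ ℤ N 0) = 1 :=
    finrank_singularHomology_zero_eq_one_of_connected_four
  have hb4 : Module.finrank ℤ (singularHomology ℤ ℤ N 4) = 1 :=
    finrank_singularHomology_four_eq_one μ
  have hb2 : Module.finrank ℤ (singularHomology ℤ ℤ N 2) = 1 := hH2
  have hb3 : Module.finrank ℤ (singularHomology ℤ ℤ N 3) = k := by
    have hq : IsOrientableOver ℚ N 4 := isOrientableOver_of_int_holds N ℚ ⟨μ⟩
    have e := bettiNumber_eq_bettiNumber_of_add_eq_holds ℚ N 4 hq (show 1 + 3 = 4 by norm_num)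
    rw [← bettiNumber_int_eq_rat, ← bettiNumber_int_eq_rat] at e
    exact e.symm.trans hb1
  have hχ : relEuler ℤ ℤ N ∅ = 3 - 2 * k := by
    rw [(finRelHomology_of_compactSpace_four N).relEuler_empty_eq_sum]
    simp only [Finset.sum_range_succ, Finset.sum_range_zero, hb0, hb1, hb2, hb3, hb4]
    push_cast
    ring
  -- signature `σ(N, μ) = 1`: `b⁺ + b⁻ = b₂ = 1` and `b⁺ ≥ 1`
  have hsig : μ.signature = 1 := by
    rw [hrank] at hsum
    have hp : sigPos Q.toQuadraticMap = 1 := by omega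
    have hn : sigNeg Q.toQuadraticMap = 0 := by omega
    rw [hsigdef, hp, hn]
    norm_num
  -- the two Chern-number identities in coordinates: `c² = 9 - 4k`, `2g - 2 = 1 + c m`
  have h1S : (Module.finrank ℤ ↥(singularHomology ℤ ℤ S 1) : ℤ) = 2 * g := by
    have h : Module.finrank ℤ ↥(singularHomology ℤ ℤ S 1) = 2 * g := hH1S
    rw [h]; push_cast; ring
  rw [hKK2, hχ, hsig] at hKK
  rw [h1S, hσσ, hKσ, hmm] at hadj
  -- arithmetic: `(2g - 3)² = (c m)² = c² = 9 - 4k`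
  have hcm : c * m = 2 * g - 3 := by linarith
  have hsq : (2 * (g : ℤ) - 3) ^ 2 = 9 - 4 * k := by
    rw [← hcm]
    calc (c * m) ^ 2 = (c * c) * (m * m) := by ring
      _ = 9 - 4 * k := by rw [hmm, mul_one]; linarith
  have key : (k : ℤ) + g * g = 3 * g := by linarith [hsq]
  exact_mod_cast key

end Summit.SmoothPoincare4.SmoothPoincare4.Theorems.OrigamiRung.PairRigidityEndgame

end
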